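import Literature.Computability.MetaComplexity.KrajicekRamseyReduction
import Mathlib.Tactic.Linarith
import Mathlib.Tactic.Ring
import HarnessLib

/-!
# The tautology theorem with size and depth bounds (bounded completeness of `textbookFrege`)

Support layer for bounded-depth Frege REDUCTIONS. `TextbookFregeCompleteness.lean` proves that
every tautology is derivable in `textbookFrege` (Shoenfield's tautology theorem) but gives no
account of the size or depth of the derivation; `FregeBounded.lean` has the decomposition rules
of that proof in bounded form (`TextbookFrege.BD D B ℓ φ`: at most `ℓ` lines, each of disjunct
depth `≤ D` and size `≤ B`). Here the two are combined:

* `TextbookFrege.tautS` — if `⋁L` is a tautology whose members have disjunct depth `≤ p`, then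
  `BD D B (shoenfieldLines (2·msum L + 1)) (⋁L)` for every `D ≥ p + 6` and `B ≥ 24·msum L + 48`,
  where `shoenfieldLines n = 2^n · 60 (n+1)²`: an exponential (in the size) but EXPLICIT bound, and —
  the point — a derivation that never leaves depth `p + 6`;
* `TextbookFrege.tautB` — the same for a single tautology `φ`;
* `TextbookFrege.BD.subst` — bounded derivations are closed under substitution, with the depth
  growing by a bound on the depths of the substituted formulas and the size by a factor.

Typical use (Krajíček 2019, §15.4; Ben-Sasson 2002): a constant-size tautological "skeleton" is
derived by `tautB` and then instantiated by `BD.subst` with large but shallow formulas, giving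
polynomial-size constant-depth derivations without hand-built proofs.

Relation to `TseitinDepthFregeTransfer.lean` (landed the same day): its `tautSeqS` is the
truth-table form of bounded completeness (GIRS Lemma 4: case analysis over the `2^k` assignments of
a given variable list, `2^k · poly` lines at depth `altDepth + 8`); `tautS` here is Shoenfield's
structural induction instrumented (`2^{2·msum} · poly` lines at disjunct depth `+ 6`, no variable
list or `vars` bookkeeping). The two are interchangeable for constant-size skeletons; `BD.subst`
(bounded derivations under substitution, as opposed to `substProofBD` for whole proofs) is new.

Sources: J. R. Shoenfield, *Mathematical Logic* (1967), §3.1 (tautology theorem); J. Krajíček,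
*Bounded arithmetic, propositional logic, and complexity theory* (1995), §4.3–4.4 (depth and size
of Frege proofs; every tautology in `k` atoms has a constant-depth proof of size `2^{O(k)}`). The
bookkeeping is folklore.
-/

namespace Literature.Computability.MetaComplexity

open Complexity Complexity.PropForm

namespace TextbookFrege

variable {D B p : ℕ}

/-! ### Measures -/

/-- Every formula has positive weight. [folklore] -/
theorem one_le_weight (A : PropForm ℕ) : 1 ≤ weight A := by
  cases A <;> simp [weight]

/-- A list is no longer than its total weight. [folklore] -/
theorem length_le_weightL (L : List (PropForm ℕ)) : L.length ≤ weightL L := by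
  induction L with
  | nil => simp
  | cons A L ih => have := one_le_weight A; rw [weightL_cons, List.length_cons]; omega

/-- The weight is at most twice the size. [folklore] -/
theorem weight_le_two_mul_size (A : PropForm ℕ) : weight A ≤ 2 * A.size := by
  induction A <;> simp only [weight, size] <;> omega

/-- The total weight is at most twice the member sum. [folklore] -/
theorem weightL_le_two_mul_msum (L : List (PropForm ℕ)) : weightL L ≤ 2 * msum L := by
  induction L with
  | nil => simp
  | cons A L ih =>
    have := weight_le_two_mul_size A
    rw [weightL_cons, msum_cons]; omega

/-- Moving a member to the front and deleting its other copies does not increase the member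
sum. [folklore] -/
theorem size_add_msum_filter_le {A : PropForm ℕ} :
    ∀ {L : List (PropForm ℕ)}, A ∈ L → A.size + 1 + msum (L.filter (· ≠ A)) ≤ msum L
  | [], hA => absurd hA List.not_mem_nil
  | X :: L, hA => by
    rw [List.filter_cons, msum_cons]
    by_cases hAX : A = X
    · subst hAX
      rw [if_neg (by simp)]
      have := msum_le_of_sublist (List.filter_sublist (p := fun C => decide (C ≠ A)) (l := L))
      omega
    · have hA' : A ∈ L := (List.mem_cons.1 hA).resolve_left hAX
      have := size_add_msum_filter_le hA'
      rw [if_pos (by simpa using fun h => hAX h.symm), msum_cons]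
      omega

/-! ### Depth of the pieces of a decomposition -/

/-- A disjunct is no deeper than the disjunction. [folklore] -/
theorem dd_le_dd_disj_left (X Y : PropForm ℕ) : X.dd ≤ (disj X Y).dd := by
  rw [dd_disj]; exact le_max_left _ _

/-- A disjunct is no deeper than the disjunction. [folklore] -/
theorem dd_le_dd_disj_right (X Y : PropForm ℕ) : Y.dd ≤ (disj X Y).dd := by
  rw [dd_disj]; exact le_max_right _ _

/-- A conjunct is no deeper than the conjunction. [folklore] -/
theorem dd_le_dd_conj_left (X Y : PropForm ℕ) : X.dd ≤ (conj X Y).dd := by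
  have := altDepthAux_le_altDepthAux_succ 3 2 X
  rw [dd_conj]; unfold dd; omega

/-- A conjunct is no deeper than the conjunction. [folklore] -/
theorem dd_le_dd_conj_right (X Y : PropForm ℕ) : Y.dd ≤ (conj X Y).dd := by
  have := altDepthAux_le_altDepthAux_succ 3 2 Y
  rw [dd_conj]; unfold dd; omega

/-- `¬X` is no deeper than `¬(X ∨ Y)`. [folklore] -/
theorem dd_neg_le_dd_neg_disj_left (X Y : PropForm ℕ) : (neg X).dd ≤ (neg (disj X Y)).dd := by
  have := altDepthAux_le_dd_succ 1 X
  simp only [dd_neg, altDepthAux_one_disj]; omega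

/-- `¬Y` is no deeper than `¬(X ∨ Y)`. [folklore] -/
theorem dd_neg_le_dd_neg_disj_right (X Y : PropForm ℕ) : (neg Y).dd ≤ (neg (disj X Y)).dd := by
  have := altDepthAux_le_dd_succ 1 Y
  simp only [dd_neg, altDepthAux_one_disj]; omega

/-- `¬X` is no deeper than `¬(X ∧ Y)`. [folklore] -/
theorem dd_neg_le_dd_neg_conj_left (X Y : PropForm ℕ) : (neg X).dd ≤ (neg (conj X Y)).dd := by
  have := altDepthAux_le_altDepthAux_succ 1 2 X
  simp only [dd_neg, altDepthAux_one_conj]; omega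

/-- `¬Y` is no deeper than `¬(X ∧ Y)`. [folklore] -/
theorem dd_neg_le_dd_neg_conj_right (X Y : PropForm ℕ) : (neg Y).dd ≤ (neg (conj X Y)).dd := by
  have := altDepthAux_le_altDepthAux_succ 1 2 Y
  simp only [dd_neg, altDepthAux_one_conj]; omega

/-! ### The line budget -/

/-- The line budget of the bounded tautology theorem for sequents of weight `< n`:
`2^n · 60 (n+1)²`. [folklore] -/
def shoenfieldLines (n : ℕ) : ℕ :=
  2 ^ n * (60 * (n + 1) ^ 2)

/-- The budget absorbs one decomposition step (two recursive calls, a connective rule and a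
structural rearrangement). [folklore] -/
theorem shoenfieldLines_step (n : ℕ) :
    2 * shoenfieldLines n + 6 * n ^ 2 + 41 * n + 115 ≤ shoenfieldLines (n + 1) := by
  unfold shoenfieldLines
  have ht : n + 1 ≤ 2 ^ n := Nat.succ_le_of_lt n.lt_two_pow_self
  have e : 2 ^ (n + 1) = 2 * 2 ^ n := by rw [pow_succ]; ring
  rw [e]
  set t := 2 ^ n with hteq
  nlinarith [ht]

/-- The budget absorbs the axiom cases. [folklore] -/
theorem shoenfieldLines_base (n : ℕ) : 95 + 12 * n ≤ shoenfieldLines (n + 1) := by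
  unfold shoenfieldLines
  have ht : 1 ≤ 2 ^ (n + 1) := Nat.one_le_two_pow
  set t := 2 ^ (n + 1)
  nlinarith [ht]

/-- The budget is monotone. [folklore] -/
theorem shoenfieldLines_mono {m n : ℕ} (h : m ≤ n) : shoenfieldLines m ≤ shoenfieldLines n := by
  unfold shoenfieldLines
  exact Nat.mul_le_mul (Nat.pow_le_pow_right (by norm_num) h)
    (Nat.mul_le_mul_left _ (Nat.pow_le_pow_left (by omega) 2))

/-! ### The bounded tautology theorem -/

/-- **Inductive step with bounds.** If every tautology `⋁L'` of weight `< n` (with the member-sum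
invariant `msum L' + n ≤ M` and members of disjunct depth `≤ p`) has a `BD D B m`-derivation,
then a tautology `⋁(A :: L)` with `A` not atom-like and `weight A + weightL L ≤ n` has a
`BD D B (2m + 51)`-derivation: decompose `A` by `consDisjS`, `consNegNegS`, `consNegDisjS`,
`consConjS`, `consNegConjS`. [Shoenfield 1967, §3.1 (tautology theorem, inductive cases)]
[folklore] -/
theorem consStepS (hD : p + 6 ≤ D) {M n m : ℕ} (hB : 8 * M + 40 ≤ B)
    (ih : ∀ L : List (PropForm ℕ), weightL L < n → msum L + n ≤ M → (∀ X ∈ L, X.dd ≤ p) →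
      (disjList L).IsTautology → BD D B m (disjList L))
    (A : PropForm ℕ) (L : List (PropForm ℕ)) (hA : atomLike A = false)
    (hw : weight A + weightL L ≤ n) (hM : A.size + 1 + msum L + (n + 1) ≤ M)
    (hp : ∀ X ∈ A :: L, X.dd ≤ p) (ht : (disjList (A :: L)).IsTautology) :
    BD D B (2 * m + 51) (disjList (A :: L)) := by
  have hpA : A.dd ≤ p := hp A List.mem_cons_self
  have hpL : ∀ X ∈ L, X.dd ≤ p := fun X hX => hp X (List.mem_cons_of_mem _ hX)
  have hdL : (disjList L).dd ≤ p := dd_disjList_le hpL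
  have hndL : (neg (disjList L)).dd ≤ p + 2 := dd_neg_disjList_le hpL
  have hsL : (disjList L).size = msum L + 1 := size_disjList_eq_msum L
  match A, hA, hw, ht, hpA, hM with
  | var _, hA, _, _, _, _ => simp [atomLike] at hA
  | const _, hA, _, _, _, _ => simp [atomLike] at hA
  | neg (var _), hA, _, _, _, _ => simp [atomLike] at hA
  | neg (const _), hA, _, _, _, _ => simp [atomLike] at hA
  | disj X Y, _, hw, ht, hpA, hM =>
    have hX : X.dd ≤ p := (dd_le_dd_disj_left X Y).trans hpA
    have hY : Y.dd ≤ p := (dd_le_dd_disj_right X Y).trans hpA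
    have h := ih (X :: Y :: L) (by simp only [weightL_cons, weight] at hw ⊢; omega)
      (by simp only [msum_cons, size] at hM ⊢; omega)
      (by
        intro Z hZ
        simp only [List.mem_cons] at hZ
        rcases hZ with rfl | rfl | hZ
        · exact hX
        · exact hY
        · exact hpL Z hZ)
      (fun σ => by
        have := ht σ; simp only [disjList_cons, eval, Bool.or_eq_true] at this ⊢; tauto)
    exact (consDisjS h).mono (by omega)
  | neg (neg X), _, hw, ht, hpA, hM =>
    have hnX : (neg X).dd ≤ p := (dd_le_dd_neg (neg X)).trans hpA
    have hX : X.dd ≤ p := (dd_le_dd_neg X).trans hnX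
    have h := ih (X :: L) (by simp only [weightL_cons, weight] at hw ⊢; omega)
      (by simp only [msum_cons, size] at hM ⊢; omega)
      (by
        intro Z hZ
        rcases List.mem_cons.1 hZ with rfl | hZ
        · exact hX
        · exact hpL Z hZ)
      (fun σ => by have := ht σ; simpa [disjList_cons, eval] using this)
    refine (consNegNegS h (by omega) (by omega) ?_).mono (by omega)
    simp only [size_disjList_cons, size] at hM ⊢; omega
  | neg (disj X Y), _, hw, ht, hpA, hM =>
    have hnX : (neg X).dd ≤ p := (dd_neg_le_dd_neg_disj_left X Y).trans hpA
    have hnY : (neg Y).dd ≤ p := (dd_neg_le_dd_neg_disj_right X Y).trans hpA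
    have hX : X.dd ≤ p := (dd_le_dd_neg X).trans hnX
    have hY : Y.dd ≤ p := (dd_le_dd_neg Y).trans hnY
    have hwX := one_le_weight X
    have hwY := one_le_weight Y
    have h₁ := ih (neg X :: L) (by simp only [weightL_cons, weight] at hw ⊢; omega)
      (by simp only [msum_cons, size] at hM ⊢; omega)
      (by
        intro Z hZ
        rcases List.mem_cons.1 hZ with rfl | hZ
        · exact hnX
        · exact hpL Z hZ)
      (fun σ => by
        have := ht σ
        simp only [disjList_cons, eval, Bool.or_eq_true, Bool.not_eq_true',
          Bool.or_eq_false_iff] at this ⊢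
        tauto)
    have h₂ := ih (neg Y :: L) (by simp only [weightL_cons, weight] at hw ⊢; omega)
      (by simp only [msum_cons, size] at hM ⊢; omega)
      (by
        intro Z hZ
        rcases List.mem_cons.1 hZ with rfl | hZ
        · exact hnY
        · exact hpL Z hZ)
      (fun σ => by
        have := ht σ
        simp only [disjList_cons, eval, Bool.or_eq_true, Bool.not_eq_true',
          Bool.or_eq_false_iff] at this ⊢
        tauto)
    refine (consNegDisjS h₁ h₂ (by omega) (by omega) (by omega) ?_).mono (by omega)
    simp only [size] at hM; omega
  | conj X Y, _, hw, ht, hpA, hM =>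
    have hX : X.dd ≤ p := (dd_le_dd_conj_left X Y).trans hpA
    have hY : Y.dd ≤ p := (dd_le_dd_conj_right X Y).trans hpA
    have hwX := one_le_weight X
    have hwY := one_le_weight Y
    have h₁ := ih (X :: L) (by simp only [weightL_cons, weight] at hw ⊢; omega)
      (by simp only [msum_cons, size] at hM ⊢; omega)
      (by
        intro Z hZ
        rcases List.mem_cons.1 hZ with rfl | hZ
        · exact hX
        · exact hpL Z hZ)
      (fun σ => by
        have := ht σ
        simp only [disjList_cons, eval, Bool.or_eq_true, Bool.and_eq_true] at this ⊢
        tauto)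
    have h₂ := ih (Y :: L) (by simp only [weightL_cons, weight] at hw ⊢; omega)
      (by simp only [msum_cons, size] at hM ⊢; omega)
      (by
        intro Z hZ
        rcases List.mem_cons.1 hZ with rfl | hZ
        · exact hY
        · exact hpL Z hZ)
      (fun σ => by
        have := ht σ
        simp only [disjList_cons, eval, Bool.or_eq_true, Bool.and_eq_true] at this ⊢
        tauto)
    refine (consConjS h₁ h₂ (by omega) (by omega) (by omega) ?_).mono (by omega)
    simp only [size] at hM; omega
  | neg (conj X Y), _, hw, ht, hpA, hM =>
    have hnX : (neg X).dd ≤ p := (dd_neg_le_dd_neg_conj_left X Y).trans hpA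
    have hnY : (neg Y).dd ≤ p := (dd_neg_le_dd_neg_conj_right X Y).trans hpA
    have hX : X.dd ≤ p := (dd_le_dd_neg X).trans hnX
    have hY : Y.dd ≤ p := (dd_le_dd_neg Y).trans hnY
    have h := ih (neg X :: neg Y :: L) (by simp only [weightL_cons, weight] at hw ⊢; omega)
      (by simp only [msum_cons, size] at hM ⊢; omega)
      (by
        intro Z hZ
        simp only [List.mem_cons] at hZ
        rcases hZ with rfl | rfl | hZ
        · exact hnX
        · exact hnY
        · exact hpL Z hZ)
      (fun σ => by
        have := ht σ
        simp only [disjList_cons, eval, Bool.or_eq_true, Bool.not_eq_true',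
          Bool.and_eq_false_iff] at this ⊢
        tauto)
    refine (consNegConjS h (by omega) (by omega) (by omega) ?_).mono (by omega)
    simp only [size] at hM; omega

/-- **The tautology theorem with bounds (induction).** Every tautology `⋁L` of weight `< n`
whose members have disjunct depth `≤ p` has a `BD D B (shoenfieldLines n)`-derivation, provided
`D ≥ p + 6`, `msum L + n ≤ M` and `B ≥ 8 M + 40`: either some member is not atom-like (move it to
the front, `subsetB`, and decompose it, `consStepS`), or `L` contains `⊤`, `¬⊥` or a
complementary pair (`exists_axiom_of_isTautology`).
[Shoenfield 1967, §3.1 (tautology theorem); Krajíček 1995, §4.3–4.4] [folklore] -/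
theorem tautAuxS (hD : p + 6 ≤ D) {M : ℕ} (hB : 8 * M + 40 ≤ B) :
    ∀ (n : ℕ) (L : List (PropForm ℕ)), weightL L < n → msum L + n ≤ M →
      (∀ X ∈ L, X.dd ≤ p) → (disjList L).IsTautology → BD D B (shoenfieldLines n) (disjList L)
  | 0, _, hn, _, _, _ => absurd hn (Nat.not_lt_zero _)
  | n + 1, L, hn, hM, hp, ht => by
    classical
    have hlenL : L.length ≤ n := (length_le_weightL L).trans (by omega)
    have hsL : (disjList L).size = msum L + 1 := size_disjList_eq_msum L
    have hD4 : p + 4 ≤ D := by omega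
    by_cases hex : ∃ A ∈ L, atomLike A = false
    · obtain ⟨A, hAL, hA⟩ := hex
      have hsub₁ : ∀ X ∈ A :: L.filter (· ≠ A), X ∈ L := by
        intro X hX
        rcases List.mem_cons.1 hX with rfl | hX
        · exact hAL
        · exact List.mem_of_mem_filter hX
      have hsub₂ : ∀ X ∈ L, X ∈ A :: L.filter (· ≠ A) := by
        intro X hX
        by_cases hXA : X = A
        · exact hXA ▸ List.mem_cons_self
        · exact List.mem_cons_of_mem _ (List.mem_filter.2 ⟨hX, by simpa using hXA⟩)
      have hw := weight_add_weightL_filter_le hAL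
      have hms := size_add_msum_filter_le hAL
      have hlen₁ : (A :: L.filter (· ≠ A)).length ≤ n := by
        have h1 := length_le_weightL (L.filter (· ≠ A))
        have h2 := one_le_weight A
        rw [List.length_cons]; omega
      have hcons : BD D B (2 * shoenfieldLines n + 51) (disjList (A :: L.filter (· ≠ A))) :=
        consStepS hD hB (fun L' h1 h2 h3 h4 => tautAuxS hD hB n L' h1 h2 h3 h4) A _ hA
          (by omega) (by omega) (fun X hX => hp X (hsub₁ X hX))
          (isTautology_disjList_of_subset hsub₂ ht)
      have hs₁ : (disjList (A :: L.filter (· ≠ A))).size ≤ msum L + 1 := by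
        rw [size_disjList_eq_msum, msum_cons]; omega
      refine (subsetB hcons hsub₁ hp hD4 (by omega)).mono ?_
      have hstep := shoenfieldLines_step n
      have e1 : (A :: L.filter (· ≠ A)).length * (35 + 6 * L.length) ≤ n * (35 + 6 * n) :=
        Nat.mul_le_mul hlen₁ (by omega)
      nlinarith [e1, hstep]
    · have hat : ∀ A ∈ L, atomLike A = true := by
        intro A hA
        by_contra h'
        exact hex ⟨A, hA, by simpa using h'⟩
      have hbase := shoenfieldLines_base n
      rcases exists_axiom_of_isTautology hat ht with htop | hbot | ⟨x, hx, hnx⟩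
      · have h0 : BD D B 4 (disjList [const true]) := topS (by omega) (by omega)
        refine (subsetB h0 (L := [const true]) (by simpa using htop) hp hD4 ?_).mono ?_
        · simp only [disjList_cons, disjList_nil, size]; omega
        · simp only [List.length_cons, List.length_nil]; nlinarith
      · have h0 : BD D B (1 + 3) (disjList [neg (const false)]) :=
          unitS (negBotB (by omega) (by omega)) (by omega) (by simp only [size]; omega)
        refine (subsetB h0 (L := [neg (const false)]) (by simpa using hbot) hp hD4 ?_).mono ?_
        · simp only [disjList_cons, disjList_nil, size]; omega
        · simp only [List.length_cons, List.length_nil]; nlinarith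
      · have h0 : BD D B 12 (disjList [neg (var x), var x]) :=
          axS (var x) (by simp only [dd_var]; omega) (by simp only [size]; omega)
        refine (subsetB h0 (L := [neg (var x), var x]) (by simp [hx, hnx]) hp hD4 ?_).mono ?_
        · simp only [disjList_cons, disjList_nil, size]; omega
        · simp only [List.length_cons, List.length_nil]; nlinarith

/-- **The tautology theorem with size and depth bounds, sequent form.** If `⋁L` is a tautology
and every member of `L` has disjunct depth `≤ p`, then for every `D ≥ p + 6` and
`B ≥ 24·msum L + 48` there is a `textbookFrege`-derivation of `⋁L` with at most
`shoenfieldLines (2·msum L + 1)` lines, each of disjunct depth `≤ D` and size `≤ B`.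
[Shoenfield 1967, §3.1; Krajíček 1995, §4.3–4.4] [folklore] -/
theorem tautS {L : List (PropForm ℕ)} (ht : (disjList L).IsTautology) (hp : ∀ X ∈ L, X.dd ≤ p)
    (hD : p + 6 ≤ D) (hB : 24 * msum L + 48 ≤ B) :
    BD D B (shoenfieldLines (2 * msum L + 1)) (disjList L) :=
  tautAuxS hD (M := 3 * msum L + 1) (by omega) (2 * msum L + 1) L
    (by have := weightL_le_two_mul_msum L; omega) (by omega) hp ht

/-- **The tautology theorem with size and depth bounds.** A tautology `φ` of disjunct depth
`≤ p` has, for `D ≥ p + 6` and `B ≥ 24·|φ| + 80`, a derivation with at most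
`shoenfieldLines (2|φ| + 3) + 8` lines of disjunct depth `≤ D` and size `≤ B` — hence
(`BD.exists_isDepthProofOf`) a depth-`(D+1)` proof of size at most that times `B`.
[Shoenfield 1967, §3.1; Krajíček 1995, §4.3–4.4] [folklore] -/
theorem tautB {φ : PropForm ℕ} (ht : φ.IsTautology) (hp : φ.dd ≤ p) (hD : p + 6 ≤ D)
    (hB : 24 * φ.size + 80 ≤ B) : BD D B (shoenfieldLines (2 * φ.size + 3) + 8) φ := by
  have h1 : BD D B (shoenfieldLines (2 * msum [φ] + 1)) (disjList [φ]) :=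
    tautS (L := [φ]) (fun σ => by simpa [disjList, eval] using ht σ)
      (fun X hX => by rw [List.mem_singleton.1 hX]; exact hp) hD
      (by simp only [msum_cons, msum_nil]; omega)
  simp only [msum_cons, msum_nil, disjList_cons, disjList_nil] at h1
  have h2 : shoenfieldLines (2 * (φ.size + 1 + 0) + 1) = shoenfieldLines (2 * φ.size + 3) := by ring_nf
  rw [h2] at h1
  have hl1 := altDepthAux_le_dd_succ 1 φ
  exact removeBotB h1 (by rw [dd_neg]; omega) (by omega)

/-! ### Substitution into bounded derivations -/

/-- A derivation from no hypotheses stays one under substitution (line-wise).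
[Krajíček 1995, Def. 4.4.1–4.4.2] [folklore] -/
theorem isDerivation_map_subst {π : List (PropForm ℕ)} (h : textbookFrege.IsDerivation ∅ π)
    (τ : ℕ → PropForm ℕ) : textbookFrege.IsDerivation ∅ (π.map (PropForm.subst τ)) := by
  intro k hk
  rw [List.length_map] at hk
  rcases h k hk with hm | hinf
  · exact absurd hm (Set.notMem_empty _)
  · right
    rw [List.getElem_map, ← List.map_take]
    exact hinf.map_subst τ

/-- **Bounded derivations are closed under substitution.** If every `σ x` has all auxiliary
depths `≤ T` and size `≤ Z` (`Z ≥ 1`), then a `BD D B ℓ`-derivation of `φ` becomes a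
`BD (D + T) (B · Z) ℓ`-derivation of `φσ`. [Krajíček 1995, §4.3–4.4 (substitution instances of
proofs)] [folklore] -/
theorem BD.subst {ℓ : ℕ} {φ : PropForm ℕ} {σ : ℕ → PropForm ℕ} {T Z : ℕ}
    (hT : ∀ x c, altDepthAux c (σ x) ≤ T) (hZ : ∀ x, (σ x).size ≤ Z) (hZ1 : 1 ≤ Z)
    (h : BD D B ℓ φ) : BD (D + T) (B * Z) ℓ (φ.subst σ) := by
  obtain ⟨π, hder, hlast, hlen, hok⟩ := h
  refine ⟨π.map (PropForm.subst σ), isDerivation_map_subst hder σ,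
    by rw [List.getLast?_map, hlast]; rfl, by rwa [List.length_map], fun ψ hψ => ?_⟩
  obtain ⟨χ, hχ, rfl⟩ := List.mem_map.1 hψ
  obtain ⟨hd, hsz⟩ := hok χ hχ
  constructor
  · have := KrajicekRamsey.altDepthAux_subst_le hT χ 3
    unfold dd at hd ⊢; omega
  · exact (KrajicekRamsey.size_subst_le hZ hZ1 χ).trans (Nat.mul_le_mul_right _ hsz)

end TextbookFrege

end Literature.Computability.MetaComplexity
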